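import Summits.BirchSwinnertonDyer.BirchSwinnertonDyer.Theorems.EisensteinPrimesResidualDevissageNonsplitLocal
import HarnessLib

/-!
# Representatives WITHOUT repetition for the places of `K_∞` above a finitely decomposed place, and the local data at `v̄` of
# the base-changed rational line at a NON-SPLIT multiplicative Eisenstein prime
# (cell `bsd-eis`, seat `bsd-line-x2-p2` gen 6, D-0154 KEY row 5; crux 4 `BSDpOnCellC` line b1; part 1 of 2 — sequel of g5's
# `…ResidualDevissage{CountNonsplitIdentity, Surjectivity, NonsplitLocal}`, feeding `…ResidualDevissageNonsplitSurjective`)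

HONEST FRAMING (cell `bsd-eis`, run/shared/lean/pub/bsd-eis/): Galois-cohomology bookkeeping on constructed objects; no
definition, no named fact, no `sorry`, no `Theses` import; nothing about BSD or a main conjecture is asserted; nothing booked; no
label or count moves. Helper `--supports stmt-BirchSwinnertonDyer-19034`; closes no stub.

Purpose. The ONE input left by g5 in the «`≥`» half of the residual λ-count at a non-split multiplicative Eisenstein prime — the
residual surjectivity `R(E_K[p]) ↠ R(E_K[p]/S)`, reduced in `…ResidualDevissageSurjectivity` (p636532) to (Glob) + (Loc) — is
discharged in part 2 from the two clauses of CGLS22 Cor. 1.2.6 (`cor126_residualCharacter_globalLift` / `…_localSurjective`,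
p639393, PUBLISHED). Those facts are stated, as printed, over PAIRWISE DISTINCT places of `K_∞` above `v̄` and under the four local
hypotheses «`θ|_{G_v̄} ≠ 𝟙, ω`» for the sub- and quotient characters; this file supplies exactly these two ingredients.

* §1 `exists_reps_distinct_places` — for a place `v` finitely decomposed in `K_∞` (`D_v ⊄ ker κ`) there is `c` with: the `p^c`
  elements `τ i`, `κ(τ i) = i`, give PAIRWISE DISTINCT places of `K_∞` above `v` (`κ(τ j) ∉ κ(τ i)·κ(D_v)`), AND every local
  condition «`res_{ker κ ⊓ D_v}(conj_σ x) = 0`, all `σ`» follows from the `p^c` of them (`κ(D_v) = p^c ℤ_p` EXACTLY: `c` = the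
  minimal valuation on `κ(D_v) ∖ 0`; the tree's `forall_resOfLe_conjH1_eq_zero_of_reps` took ANY valuation, which may repeat places).
* §2 `exists_stableSubgroup_localData_of_not_split` — the base-changed rational line `S ≤ E_K[p]` at a non-split multiplicative
  odd Eisenstein prime with ALL its local data at `v̄` exported: `#S = #(E_K[p]/S) = p`; `D_{v̄}` fixes neither `S` nor `E_K[p]/S`
  pointwise and acts on neither through `ω`; no `(ker κ ⊓ D_{v̄})`-fixed quotient vector (g5's p636269 §3 stopped BEFORE any named
  fact is applied); `sf_split_and_good` — the standing hypotheses on `Sf` (finite, prime to `p`, over split primes; good reduction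
  off `Sf ∪ {w ∣ p}`) at a Heegner field.

References: [CastellaGrossiLeeSkinner2022] §1.2 (hypothesis θ|_{G_v̄} ≠ 𝟙, ω), Cor. 1.2.6, §1.4 (e-print TeX L594–L880; arXiv:2008.02571
Cor. 15, Props. 17–18); [KellerYin2024] Thm. 1.4.1, Rem. 1.4.2 (arXiv:2402.12781v2); [GreenbergLNM1716] §1; [Washington1997] §13.1;
[SilvermanATAEC1994] V.5.3–5.4; [Brink2007] Cor. 1; [SerreGaloisCohomology1997] I.§2.5; cell p636269, p637140 (g5), p626493 (g4).
-/

set_option autoImplicit false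
set_option linter.dupNamespace false -- the summit namespace `…BirchSwinnertonDyer.BirchSwinnertonDyer.Theorems` (Sub = Summit, D-0017) trips it

noncomputable section

open scoped Classical Pointwise

namespace Summit.BirchSwinnertonDyer.BirchSwinnertonDyer.Theorems.ResidualDevissageNonsplitLocalData

open WeierstrassCurve NumberField IsDedekindDomain Field
  Literature.NumberTheory.EllipticCurves Literature.NumberTheory.EllipticCurves.IwasawaAlgebra
  Literature.NumberTheory.EllipticCurves.GreenbergSelmer
  Literature.NumberTheory.EllipticCurves.GreenbergVatsal2000
  Literature.NumberTheory.GaloisRepresentations IsDedekindDomain.HeightOneSpectrum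
  Literature.NumberTheory.EllipticCurves.Rank1Residual
  Literature.NumberTheory.EllipticCurves.FineSelmerCoefficientMap
  Summit.BirchSwinnertonDyer.Rank1Residual.X11b Summit.BirchSwinnertonDyer.Rank1Residual.X11b.AcSelmer
  Summit.BirchSwinnertonDyer.Rank1Residual.X2.ResidualDevissageModules
  Summit.BirchSwinnertonDyer.BirchSwinnertonDyer.Theorems
  Summit.BirchSwinnertonDyer.BirchSwinnertonDyer.Theorems.ResidualDevissageCountNonsplit
  Summit.BirchSwinnertonDyer.BirchSwinnertonDyer.Theorems.ResidualDevissageCountNonsplitIdentity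
  Summit.BirchSwinnertonDyer.BirchSwinnertonDyer.Theorems.ResidualDevissageNonsplitLocal
  Summit.BirchSwinnertonDyer.BirchSwinnertonDyer.Theorems.CumulativeHeegnerInclusionAtThreeResidualDevissage
  Summit.BirchSwinnertonDyer.BirchSwinnertonDyer.Theorems.CumulativeHeegnerInclusionAtThreeLineBaseChange
  Summit.BirchSwinnertonDyer.BirchSwinnertonDyer.Theorems.CumulativeHeegnerInclusionAtThreeTowerFixed
  Summit.BirchSwinnertonDyer.BirchSwinnertonDyer.Theorems.CumulativeHeegnerInclusionAtThreeStubB1LineDeterminant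
  Summit.BirchSwinnertonDyer.BirchSwinnertonDyer.Theorems.CumulativeHeegnerInclusionAtThreeBadPlaces
  Summit.BirchSwinnertonDyer.BirchSwinnertonDyer.Theorems.AdditiveKoly.SplitCompletion
  Summit.BirchSwinnertonDyer.BirchSwinnertonDyer.Theorems.KellerYinLemma511NonsplitOfPrint

/-! ### §1 Representatives giving PAIRWISE DISTINCT places of `K_∞` above a finitely decomposed place -/

section Reps

variable {K : Type} [Field K] [NumberField K] {p : ℕ} [Fact p.Prime] (κ : ZpExtension K p)

/-- **Representatives for the places of `K_∞` above `v`, without repetition.** If `D_v ⊄ ker κ` (i.e. `v` is finitely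
decomposed in `K_∞ = K̄^{ker κ}`), there is `c : ℕ` — the one with `κ(D_v) = p^c ℤ_p`, i.e. the MINIMAL valuation of a non-zero
element of the closed subgroup `κ(D_v) ≤ ℤ_p` — such that (a) the `p^c` classes `i + κ(D_v)`, `i < p^c`, are pairwise distinct
(`j ∉ i + κ(D_v)` for `i ≠ j < p^c`: their difference has valuation `< c`), so that elements `τ i ∈ Γ_K` with `κ(τ i) = i` sit at
pairwise DISTINCT places of `K_∞` above `v`; and (b) for every discrete `Γ_K`-module `M` and every such `τ`, a class
`x ∈ H¹(ker κ, M)` with `res_{ker κ ⊓ D_v}(conj_{τ i} x) = 0` for all `i < p^c` has `res_{ker κ ⊓ D_v}(conj_σ x) = 0` for EVERY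
`σ ∈ Γ_K` (write `κ(σ) = i + p^c z`, `p^c z = κ(δ)`, `δ ∈ D_v`, so `σ = δ · τ i · h`, `h ∈ ker κ`; inner automorphisms act trivially and
`conj_δ` preserves the vanishing at `ker κ ⊓ D_v`). Refines the tree's `forall_resOfLe_conjH1_eq_zero_of_reps` (any valuation `c`,
places possibly repeated). [cite: Washington1997, §13.1 (closed subgroups of ℤ_p)] [cite: GreenbergLNM1716, §1 ("finitely decomposed")]
[cite: SerreGaloisCohomology1997, I.§2.5] -/
theorem exists_reps_distinct_places (v : HeightOneSpectrum (𝓞 K)) (hv : ¬ (decomp v ≤ κ.kerSubgroup)) :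
    ∃ c : ℕ,
      (∀ i j : ℕ, i < p ^ c → j < p ^ c → i ≠ j → ∀ δ ∈ decomp v,
          Multiplicative.ofAdd ((j : ℕ) : ℤ_[p]) ≠ Multiplicative.ofAdd ((i : ℕ) : ℤ_[p]) * κ δ) ∧
      ∀ (M : Type) [AddCommGroup M] [DistribMulAction (absoluteGaloisGroup K) M] [TopologicalSpace M]
        [DiscreteTopology M] (τ : ℕ → absoluteGaloisGroup K),
        (∀ i, κ (τ i) = Multiplicative.ofAdd ((i : ℕ) : ℤ_[p])) →
        ∀ x : Literature.NumberTheory.EllipticCurves.subgroupH1 κ.kerSubgroup M,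
          (∀ i, i < p ^ c → resOfLe M (inf_le_left : κ.kerSubgroup ⊓ decomp v ≤ κ.kerSubgroup)
            (Literature.NumberTheory.EllipticCurves.conjH1 κ.kerSubgroup M (τ i) x) = 0) →
          ∀ σ : absoluteGaloisGroup K,
            resOfLe M (inf_le_left : κ.kerSubgroup ⊓ decomp v ≤ κ.kerSubgroup)
              (Literature.NumberTheory.EllipticCurves.conjH1 κ.kerSubgroup M σ x) = 0 := by
  -- the closed subgroup `Z = κ(D_v) ≤ ℤ_p` and a non-zero element of it
  obtain ⟨δv, hδvD, hδv⟩ : ∃ δ ∈ decomp v, δ ∉ κ.kerSubgroup := Set.not_subset.mp hv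
  rw [ZpExtension.mem_kerSubgroup] at hδv
  let Z : AddSubgroup ℤ_[p] :=
    AddSubgroup.toSubgroup.symm ((decomp v).map
      (κ.toContinuousMonoidHom : absoluteGaloisGroup K →* Multiplicative ℤ_[p]))
  have hZmem : ∀ y : ℤ_[p], y ∈ Z ↔ ∃ δ ∈ decomp v, κ δ = Multiplicative.ofAdd y := fun y ↦ by
    change Multiplicative.ofAdd y ∈ (decomp v).map _ ↔ _
    rw [Subgroup.mem_map]
    rfl
  have hZclosed : IsClosed (Z : Set ℤ_[p]) := by
    have hc : IsCompact (((decomp v).map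
        (κ.toContinuousMonoidHom : absoluteGaloisGroup K →* Multiplicative ℤ_[p]) :
        Subgroup (Multiplicative ℤ_[p])) : Set (Multiplicative ℤ_[p])) := by
      rw [Subgroup.coe_map]
      exact (Kobayashi2003.isCompact_decomp v).image κ.toContinuousMonoidHom.continuous
    exact hc.isClosed
  -- the MINIMAL valuation `c` of a non-zero element of `Z`, attained at `u`
  have hP : ∃ c : ℕ, ∃ u ∈ Z, u ≠ 0 ∧ u.valuation = c := by
    refine ⟨((κ δv).toAdd).valuation, (κ δv).toAdd, (hZmem _).mpr ⟨δv, hδvD, rfl⟩, fun h ↦ hδv ?_, rfl⟩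
    exact Multiplicative.toAdd.injective h
  classical
  let c : ℕ := Nat.find hP
  obtain ⟨u, huZ, hu0, huc⟩ : ∃ u ∈ Z, u ≠ 0 ∧ u.valuation = c := Nat.find_spec hP
  have hmin : ∀ z ∈ Z, z ≠ 0 → c ≤ z.valuation := fun z hz hz0 ↦
    Nat.find_min' hP ⟨z, hz, hz0, rfl⟩
  refine ⟨c, fun i j hi hj hij δ hδD heq ↦ ?_, fun M _ _ _ _ τ hτ x hx σ ↦ ?_⟩
  · -- (a) `j - i ∈ Z` would have valuation `≥ c`, forcing `i ≡ j (mod p^c)`, i.e. `i = j`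
    have hδ : κ δ = Multiplicative.ofAdd (((j : ℕ) : ℤ_[p]) - (i : ℕ)) := by
      apply Multiplicative.toAdd.injective
      have h := congrArg Multiplicative.toAdd heq
      rw [toAdd_mul, toAdd_ofAdd, toAdd_ofAdd] at h
      rw [toAdd_ofAdd]
      linear_combination (-1 : ℤ_[p]) * h
    have hmemZ : ((j : ℕ) : ℤ_[p]) - (i : ℕ) ∈ Z := (hZmem _).mpr ⟨δ, hδD, hδ⟩
    have hne : ((j : ℕ) : ℤ_[p]) - (i : ℕ) ≠ 0 := by
      intro h
      exact hij (Nat.cast_injective (R := ℤ_[p]) (sub_eq_zero.mp h)).symm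
    have hval : c ≤ (((j : ℕ) : ℤ_[p]) - (i : ℕ)).valuation := hmin _ hmemZ hne
    have hspan : ((j : ℕ) : ℤ_[p]) - (i : ℕ) ∈ (Ideal.span {(p : ℤ_[p]) ^ c} : Ideal ℤ_[p]) :=
      (PadicInt.mem_span_pow_iff_le_valuation _ hne c).mpr hval
    have hcongr : ((j : ℕ) : ZMod (p ^ c)) = ((i : ℕ) : ZMod (p ^ c)) :=
      PadicInt.zmod_congr_of_sub_mem_span c ((j : ℕ) : ℤ_[p]) j i (by simp) hspan
    have hval_eq : ((j : ℕ) : ZMod (p ^ c)).val = ((i : ℕ) : ZMod (p ^ c)).val := by rw [hcongr]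
    rw [ZMod.val_natCast, ZMod.val_natCast, Nat.mod_eq_of_lt hj, Nat.mod_eq_of_lt hi] at hval_eq
    exact hij hval_eq.symm
  · -- (b) write `κ σ = i + p^c z`, `i < p^c`
    set y : ℤ_[p] := (κ σ).toAdd with hy
    set i : ℕ := (PadicInt.toZModPow c y).val with hi
    have hi_lt : i < p ^ c := ZMod.val_lt _
    have hyi : y - i ∈ Ideal.span {(p : ℤ_[p]) ^ c} := by
      rw [← PadicInt.ker_toZModPow, RingHom.mem_ker, map_sub, map_natCast, hi, ZMod.natCast_zmod_val,
        sub_self]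
    obtain ⟨z, hz⟩ := Ideal.mem_span_singleton.mp hyi
    -- `p^c z ∈ κ(D_v)`: `y - i = κ δ`
    obtain ⟨δ, hδD, hδ⟩ := (hZmem _).mp (hz ▸ huc ▸ pow_valuation_mul_mem_of_isClosed Z hZclosed huZ hu0 z :
      y - i ∈ Z)
    -- `h = (δ τ_i)⁻¹ σ ∈ ker κ`
    have hh : (δ * τ i)⁻¹ * σ ∈ κ.kerSubgroup := by
      rw [ZpExtension.mem_kerSubgroup, map_mul, map_inv, map_mul, hδ, hτ i]
      apply Multiplicative.toAdd.injective
      rw [toAdd_mul, toAdd_inv, toAdd_mul, toAdd_ofAdd, toAdd_ofAdd, toAdd_one, ← hy]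
      ring
    have hσ : σ = δ * (τ i * ((δ * τ i)⁻¹ * σ)) := by group
    rw [hσ, Literature.NumberTheory.EllipticCurves.conjH1_mul_holds, AddMonoidHom.comp_apply,
      Literature.NumberTheory.EllipticCurves.conjH1_mul_holds, AddMonoidHom.comp_apply,
      Literature.NumberTheory.EllipticCurves.conjH1_of_mem_holds κ.kerSubgroup M hh,
      AddMonoidHom.id_apply]
    exact resOfLe_conjH1_eq_zero_of_mem κ.kerSubgroup (decomp v) hδD (hx i hi_lt)

end Reps

/-! ### §2 The base-changed rational line at a non-split multiplicative Eisenstein prime, with its local data at `v̄` -/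

section LocalData

/-- **The line `S ≤ E_K[p]` and its local data at `v̄`, non-split multiplicative odd Eisenstein prime.** `W/ℚ` globally
minimal, `2 < p`, `p ‖ N` NON-split, `E[p]` reducible; `K` imaginary quadratic with `(p)` split, `v̄ ∋ p`; ANY `ℤ_p`-extension `κ`.
Then the base change `S` of a rational line `Φ ≤ E[p]` is a `Γ_K`-stable subgroup of `E_K[p]` with `#S = #(E_K[p]/S) = p` such that
the decomposition group `D_{v̄}` (i) does not fix `S` pointwise, (ii) does not fix `E_K[p]/S` pointwise, (iii) does not act on `S`
through the mod-`p` cyclotomic character, (iv) nor on `E_K[p]/S`; and (v) `E_K[p]/S` has no non-zero `(ker κ ⊓ D_{v̄})`-fixed vector.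
(i)–(ii): the non-split Tate curve — `D_{v̄}` acts on the two graded pieces through `ωχ` and `χ`, `χ` the non-trivial unramified
quadratic character (g4's `not_fix_and_not_quot_of_not_split_of_mem_primesAbove`, transported to `K`); (iii)–(iv): Weil pairing
(`det = ω`), so «cyclotomic on one piece» = «trivial on the other»; (v): a pro-`p` subgroup of `D_{v̄}` of a character of order
prime to `p`. This is g5's `exists_stableSubgroup_residualFinite_of_prop14_of_not_split` (p636269 §3) stopped BEFORE any named fact
is applied, with all four local hypotheses of CGLS §1.2 exported. [cite: CastellaGrossiLeeSkinner2022, §1.2 (hypothesis θ|_{G_v̄} ≠ 𝟙, ω), §1.4]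
[cite: SilvermanATAEC1994, Ch. V Thm. 5.3, Cor. 5.4] [cite: GreenbergVatsal2000, §2 p. 26] -/
theorem exists_stableSubgroup_localData_of_not_split
    {p : ℕ} [hp : Fact p.Prime] (W : WeierstrassCurve ℚ) [W.IsElliptic] [W.IsGloballyMinimal]
    (K : Type) [Field K] [NumberField K] (vbar : HeightOneSpectrum (𝓞 K)) (κ : ZpExtension K p)
    (hp2 : 2 < p) (hmult : Mult W p) (hns : ¬ W.HasSplitMultiplicativeReductionAtPrime p)
    (hred : Red W p) (hK : IsImaginaryQuadratic K)
    (hsplit : ((Ideal.span {(p : ℤ)}).primesOver (𝓞 K)).ncard = 2)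
    (hvbar : ((p : ℕ) : 𝓞 K) ∈ vbar.asIdeal) :
    ∃ S : StableSubgroup (absoluteGaloisGroup K) ((W.baseChange K).geomTorsion ((p : ℕ) : ℤ)),
      Nat.card S.Sub = p ∧ Nat.card S.Quot = p ∧
        (¬ ∀ g ∈ decomp vbar, ∀ x : S.Sub, g • x = x) ∧
        (¬ ∀ g ∈ decomp vbar, ∀ y : S.Quot, g • y = y) ∧
        (¬ ∀ g ∈ decomp vbar, ∀ m : S.Sub,
          g • m = ((modNCyclotomicCharacter K p g : (ZMod p)ˣ) : ZMod p).val • m) ∧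
        (¬ ∀ g ∈ decomp vbar, ∀ m : S.Quot,
          g • m = ((modNCyclotomicCharacter K p g : (ZMod p)ˣ) : ZMod p).val • m) ∧
        (∀ y : S.Quot, (∀ g : ↥(κ.kerSubgroup ⊓ decomp vbar), g • y = y) → y = 0) := by
  have hpp : p.Prime := hp.out
  have hp2' : p ≠ 2 := by omega
  haveI hEK : (W.baseChange K).IsElliptic := inferInstanceAs (W.map (algebraMap ℚ K)).IsElliptic
  haveI : IsGalois ℚ K := isGalois_of_finrank_eq_two K hK.1
  have he : vbar.asIdeal.ramificationIdx (𝓞 ℚ) = 1 :=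
    ramificationIdx_eq_one_of_card_primesOver K p hK.1 hsplit vbar hvbar
  have hf : vbar.asIdeal.inertiaDeg (𝓞 ℚ) = 1 :=
    inertiaDeg_eq_one_of_card_primesOver K p hK.1 hsplit vbar hvbar
  set v : HeightOneSpectrum (𝓞 ℚ) := vbar.under (𝓞 ℚ) with hv
  have hw : vbar.asIdeal.under (𝓞 ℚ) = v.asIdeal := by rw [hv, HeightOneSpectrum.under_asIdeal]
  have hpv : ((p : ℕ) : 𝓞 ℚ) ∈ v.asIdeal := natCast_mem_under K p vbar hvbar
  obtain ⟨Φ, hΦ⟩ := exists_isRationalLine_of_not_irr W p hred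
  have hcell : ∀ 𝔓 ∈ v.primesAbove,
      (¬ ∀ g ∈ 𝔓.decompositionSubgroup (absoluteGaloisGroup ℚ), ∀ P ∈ Φ, g • P = P) ∧
        (¬ ∀ g ∈ 𝔓.decompositionSubgroup (absoluteGaloisGroup ℚ),
          ∀ P : geomTorsion W (p : ℤ), g • P - P ∈ Φ) :=
    fun 𝔓 h𝔓 ↦ KellerYinLemma511NonsplitOfPrint.not_fix_and_not_quot_of_not_split_of_mem_primesAbove W p hp2'
      hmult hns hpv hΦ h𝔓
  obtain ⟨t, ht⟩ := exists_geomTorsion_baseChange_equiv W K ((p : ℕ) : ℤ)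
  have ht' : ∀ (σ : absoluteGaloisGroup K) (P : W.geomTorsion ((p : ℕ) : ℤ)),
      t (absGaloisRestrict ℚ K σ • P) = σ • t P := fun σ P ↦ by
    rw [← resGal_eq_absGaloisRestrict]; exact ht σ P
  obtain ⟨S, hS, hcardS⟩ := exists_stableSubgroup_corr Φ t ht' hΦ.2
  have hSub : Nat.card S.Sub = p := by rw [hcardS, hΦ.1]
  have hEp : Nat.card ((W.baseChange K).geomTorsion ((p : ℕ) : ℤ)) = p ^ 2 :=
    (W.baseChange K).natCard_geomTorsion_prime_eq_sq hpp
  have hQuot : Nat.card S.Quot = p := by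
    have h := S.natCard_eq_mul
    rw [hEp, hSub, sq] at h
    exact (Nat.eq_of_mul_eq_mul_right hpp.pos h).symm
  have hnon1 : ¬ ∀ γ ∈ decomp vbar, ∀ x : S.Sub, γ • x = x :=
    not_forall_decomp_smul_sub_eq_of_corr Φ t ht' S hS
      (not_forall_decomp_smul_eq K Φ hw he hf fun 𝔓 h𝔓 ↦ (hcell 𝔓 h𝔓).1)
  have hnon2 : ¬ ∀ γ ∈ decomp vbar, ∀ y : S.Quot, γ • y = y :=
    not_forall_decomp_smul_quot_eq_of_corr Φ t ht' S hS
      (not_forall_decomp_smul_sub_mem K Φ hw he hf fun 𝔓 h𝔓 ↦ (hcell 𝔓 h𝔓).2)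
  have hfix : ∀ y : S.Quot, (∀ g : ↥(κ.kerSubgroup ⊓ decomp vbar), g • y = y) → y = 0 :=
    eq_zero_of_fixed_of_not_forall_decomp_smul_eq κ vbar hQuot hnon2
  have hωS : ¬ ∀ g ∈ decomp vbar, ∀ m : S.Sub,
      g • m = ((modNCyclotomicCharacter K p g : (ZMod p)ˣ) : ZMod p).val • m :=
    not_forall_smul_sub_eq_cyclotomic (W.baseChange K) p S hSub (decomp vbar) hnon2
  have hωQ : ¬ ∀ g ∈ decomp vbar, ∀ m : S.Quot,
      g • m = ((modNCyclotomicCharacter K p g : (ZMod p)ˣ) : ZMod p).val • m :=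
    not_forall_smul_quot_eq_cyclotomic (W.baseChange K) p S hSub (decomp vbar) hnon1
  exact ⟨S, hSub, hQuot, hnon1, hnon2, hωS, hωQ, hfix⟩

/-- **The set `Sf` of places of `K` over `N_E` off `p` at a Heegner field**: it is finite, prime to `p`, consists of places over
rational primes SPLIT in `K`, and `E_K` has good reduction at every place outside `Sf ∪ {w ∣ p}` — the standing hypotheses on
`S = Σ ∖ {v, v̄, ∞}` of CGLS §1.2/§1.4 («every prime `ℓ ∣ N` splits in `K`»). (Factored out of g5's p636269 §3.)
[cite: CastellaGrossiLeeSkinner2022, §1.3–§1.4 (Σ ⊇ primes above Np, all split in K)] -/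
theorem sf_split_and_good {p : ℕ} [Fact p.Prime] (W : WeierstrassCurve ℚ) [W.IsElliptic]
    (K : Type) [Field K] [NumberField K] (Sf : Finset (HeightOneSpectrum (𝓞 K)))
    (hH : SatisfiesHeegnerHypothesis (W.conductorNorm ℤ) K)
    (hSf : ∀ w : HeightOneSpectrum (𝓞 K), w ∈ Sf ↔
      (((W.conductorNorm ℤ : ℤ) : 𝓞 K) ∈ w.asIdeal ∧ ((p : ℕ) : 𝓞 K) ∉ w.asIdeal)) :
    (∀ w ∈ (↑Sf : Set (HeightOneSpectrum (𝓞 K))), ((p : ℕ) : 𝓞 K) ∉ w.asIdeal ∧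
        ((w.asIdeal.under ℤ).primesOver (𝓞 K)).ncard = 2) ∧
      (∀ w : HeightOneSpectrum (𝓞 K), w ∉ (↑Sf : Set (HeightOneSpectrum (𝓞 K))) → ((p : ℕ) : 𝓞 K) ∉ w.asIdeal →
        (W.baseChange K).HasGoodReductionAt w) := by
  haveI hEK : (W.baseChange K).IsElliptic := inferInstanceAs (W.map (algebraMap ℚ K)).IsElliptic
  refine ⟨fun w hw ↦ ?_, fun w hw hpw ↦ ?_⟩
  · rw [Finset.mem_coe, hSf] at hw
    refine ⟨hw.2, ?_⟩
    obtain ⟨ℓ, hℓ, hℓw⟩ := exists_prime_natCast_mem_asIdeal w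
    haveI : Fact ℓ.Prime := ⟨hℓ⟩
    have hunder : w.asIdeal.under ℤ = Ideal.span {(ℓ : ℤ)} :=
      (liesOver_span_int K ℓ w (by exact_mod_cast hℓw)).over.symm
    have hℓN : ℓ ∣ W.conductorNorm ℤ := by
      have hmem : ((W.conductorNorm ℤ : ℕ) : ℤ) ∈ w.asIdeal.under ℤ := by
        rw [Ideal.under_def, Ideal.mem_comap, map_natCast]
        have := hw.1
        rwa [Int.cast_natCast] at this
      rw [hunder, Ideal.mem_span_singleton] at hmem
      exact_mod_cast hmem
    rw [hunder]
    exact hH ℓ hℓ hℓN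
  · by_contra hbad
    obtain ⟨ℓ, -, hℓw, hℓN⟩ := exists_prime_mem_dvd_conductorNorm_of_not_hasGoodReductionAt W K w hbad
    apply hw
    rw [Finset.mem_coe, hSf]
    refine ⟨?_, hpw⟩
    obtain ⟨m, hm⟩ := hℓN
    rw [hm, Nat.cast_mul, Int.cast_mul, Int.cast_natCast]
    exact w.asIdeal.mul_mem_right _ hℓw

end LocalData

end Summit.BirchSwinnertonDyer.BirchSwinnertonDyer.Theorems.ResidualDevissageNonsplitLocalData

end
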